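import Mathlib
import HarnessLib

/-!
# `PSL₂(ℤ) ≅ ℤ/2 ∗ ℤ/3`: the modular group modulo `±1` is the free product of `⟨S⟩` and `⟨ST⟩`,
# and crossed homomorphisms on `SL(2, ℤ)` are freely prescribed on `S` and `U = ST`

Topic `Literature/GroupTheory/SpecificGroups`; namespace `Literature.GroupTheory.SpecificGroups`
(grouping sub-namespace `ModularGroupFreeProduct`).  Everything here is PROVED; there are no named
facts and no `sorry`.

**The theorem** (Serre, *Trees*, I.4.2, Ex. 1.5.3; Serre, *Cours d'arithmétique*, VII.1; Alperin,
*PSL₂(ℤ) = ℤ₂ ∗ ℤ₃*, Amer. Math. Monthly 100 (1993) 385–386; Kurosh, *Theory of groups* II,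
§35): with `S = (0 -1; 1 0)` and `U = ST = (0 -1; 1 1)` (`S² = U³ = -1`), the homomorphism
`ℤ/2 ∗ ℤ/3 → SL(2, ℤ)/{±1}` sending the two generators to the classes of `S` and `U` is an
isomorphism.  We prove it by the **ping-pong lemma** (Mathlib's
`Monoid.CoprodI.lift_injective_of_ping_pong`) for the action on the upper half plane `ℍ`:
`S : z ↦ -1/z` maps `{re z < 0}` into `{re z > 0}`, while `U : z ↦ -1/(z+1)` and
`U² : z ↦ -1 - 1/z` map `{re z > 0}` into `{re z < 0}` (Alperin's argument, transported from
the irrationals to `ℍ`).  Since `±1` is exactly the kernel of the action of `SL(2, ℤ)` on `ℍ`, the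
statement is organised WITHOUT forming the quotient group:

* `ModularGroupFreeProduct.FP = ℤ/2 ∗ ℤ/3` (`Monoid.CoprodI` of `Multiplicative (ZMod 2)` and
  `Multiplicative (ZMod 3)`, indexed by `Bool`), generators `inS`, `inU` (the images of
  `genS = 1 mod 2`, `genU = 1 mod 3`);
* `toPerm : FP →* Equiv.Perm ℍ` (`inS ↦ (z ↦ S • z)`, `inU ↦ (z ↦ U • z)`) is **injective**
  (`toPerm_injective`, ping-pong);
* `fromSL : SL(2, ℤ) →* FP`, the unique homomorphism with `fromSL S = inS`, `fromSL U = inU`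
  (`fromSL_S`, `fromSL_U`); it is surjective (`fromSL_surjective`), kills `-1`
  (`fromSL_neg_one`), and its kernel is the kernel of the action on `ℍ` (`fromSL_eq_one_iff`);
  it is `toPerm⁻¹ ∘ (action on ℍ)`;
* **universal property of `SL(2, ℤ)` modulo `±1`** (`liftSL`, `liftSL_S`, `liftSL_U`,
  `liftSL_unique`): for any group `N` and `x, y ∈ N` with `x² = 1`, `y³ = 1` there is a unique
  homomorphism `SL(2, ℤ) →* N` with `S ↦ x`, `U ↦ y` — i.e. `SL(2, ℤ)/{±1} = ⟨S, U ∣ S², U³⟩`.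

**Crossed homomorphisms.**  For a representation `ρ` of `SL(2, ℤ)` on an `R`-module `W` with
`ρ(-1) = 1`, a crossed homomorphism (`F(gh) = F(g) + ρ(g)F(h)`; `IsCrossedHom`, the submodule
`crossedHoms ρ`) is determined by `(F(S), F(U))` (`ev_injective`), and — this is where the free
product enters, through the affine maps `v ↦ ρ(S)v + w_S`, `v ↦ ρ(U)v + w_U` of orders `2` and `3`
— **every pair `(w_S, w_U)` with `(1 + ρS)w_S = 0` and `(1 + ρU + ρU²)w_U = 0` occurs**
(`exists_isCrossedHom`, `range_ev`).  Consequently (`finrank_crossedHoms_add`,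
`finrank_range_cobd_add`), over a field in which `2` and `3` are invertible,
`dim Z¹ = 2 dim W - dim W^S - dim W^U` and `dim B¹ = dim W - dim W^{SL(2,ℤ)}`, so that
**`dim H¹(SL(2, ℤ), W) = dim W - dim W^S - dim W^U + dim W^{SL(2,ℤ)}`** — the Mayer–Vietoris count
for `ℤ/2 ∗ ℤ/3` (Serre, *Trees*, II.2.8; Brown, *Cohomology of groups*, VII.9), which through
Shapiro's lemma is Shimura's dimension formula for `H¹(Γ, ·)`, `Γ ≤ SL(2, ℤ)` of finite index
(Shimura 1971, §8.1–8.2).  This is the existence half that the tree's counting files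
(`ModularSymbolsParabolicCohomologyProofs`, `ManinSymbolsWeightK`: upper bounds from
"`S, T` generate") do not provide.

## References

* J.-P. Serre, *Trees*, Springer 1980, I.4.2 (Ex. 1.5.3) and II.2.8. [SerreTrees1980]
* J.-P. Serre, *A course in arithmetic*, GTM 7, VII.1 (generation by `S`, `T`). [Serre1973]
* R. C. Alperin, *PSL₂(ℤ) = ℤ₂ ∗ ℤ₃*, Amer. Math. Monthly 100 (1993), 385–386. [Alperin1993]
* K. S. Brown, *Cohomology of groups*, GTM 87, Springer 1982, VII.9 (Mayer–Vietoris). [Brown1982]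
* G. Shimura, *Introduction to the arithmetic theory of automorphic functions*, 1971, §8.1–8.2.
  [Shimura1971]
-/

noncomputable section

open scoped MatrixGroups Pointwise
open Matrix.SpecialLinearGroup ModularGroup UpperHalfPlane

namespace Literature.GroupTheory.SpecificGroups

namespace ModularGroupFreeProduct

/-! ### The elements `S` and `U = ST` -/

/-- `U = S T = (0 -1; 1 1) ∈ SL(2, ℤ)`, of order `6` (`U³ = -1`); it acts on `ℍ` by
`z ↦ -1/(z + 1)`. [cite: Serre1973, VII.1] -/
def U : SL(2, ℤ) := S * T

/-- Unfolding `U`. [folklore] -/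
theorem U_def : U = S * T := rfl

/-- `U³ = -1`. [cite: Serre1973, VII.1] -/
theorem U_pow_three : U ^ 3 = (-1 : SL(2, ℤ)) := by decide

/-- `T = S⁻¹ U`. [folklore] -/
theorem T_eq : T = S⁻¹ * U := by rw [U_def, inv_mul_cancel_left]

/-- `S` and `U` generate `SL(2, ℤ)` (since `S`, `T` do). [cite: Serre1973, VII.1 Thm. 2] -/
theorem closure_S_U : Subgroup.closure ({S, U} : Set SL(2, ℤ)) = ⊤ := by
  refine top_le_iff.mp ?_
  rw [← SpecialLinearGroup.SL2Z_generators]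
  refine (Subgroup.closure_le _).mpr ?_
  rintro g (rfl | rfl)
  · exact Subgroup.subset_closure (Set.mem_insert _ _)
  · rw [T_eq]
    exact mul_mem (inv_mem (Subgroup.subset_closure (Set.mem_insert _ _)))
      (Subgroup.subset_closure (Set.mem_insert_of_mem _ rfl))

/-- Two homomorphisms out of `SL(2, ℤ)` agreeing on `S` and `U` are equal. [folklore] -/
theorem hom_ext {N : Type*} [Group N] {φ ψ : SL(2, ℤ) →* N} (hS : φ S = ψ S) (hU : φ U = ψ U) :
    φ = ψ :=
  MonoidHom.eq_of_eqOn_dense closure_S_U (by rintro g (rfl | rfl) <;> assumption)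

/-! ### The free product `ℤ/2 ∗ ℤ/3` -/

/-- The orders of the two cyclic factors, indexed by `Bool`: `true ↦ 2` (the factor of `S`),
`false ↦ 3` (the factor of `U`). [folklore] -/
def ord (b : Bool) : ℕ := bif b then 2 else 3

/-- `ord true = 2`. [folklore] -/
@[simp] theorem ord_true : ord true = 2 := rfl
/-- `ord false = 3`. [folklore] -/
@[simp] theorem ord_false : ord false = 3 := rfl

/-- The factors `ℤ/2`, `ℤ/3`, written multiplicatively. [folklore] -/
abbrev Fac (b : Bool) : Type := Multiplicative (ZMod (ord b))

/-- The factors are finite. [folklore] -/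
instance (b : Bool) : Fintype (Fac b) := by
  cases b <;> dsimp [Fac, ord] <;> infer_instance

/-- The free product `FP = ℤ/2 ∗ ℤ/3`. [cite: SerreTrees1980, I.1.2] -/
abbrev FP : Type := Monoid.CoprodI Fac

/-- The generator of the factor `ℤ/2`. [folklore] -/
def genS : Fac true := Multiplicative.ofAdd (1 : ZMod 2)

/-- The generator of the factor `ℤ/3`. [folklore] -/
def genU : Fac false := Multiplicative.ofAdd (1 : ZMod 3)

/-- The image of `genS` in the free product. [folklore] -/
def inS : FP := (Monoid.CoprodI.of : Fac true →* FP) genS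

/-- The image of `genU` in the free product. [folklore] -/
def inU : FP := (Monoid.CoprodI.of : Fac false →* FP) genU

/-- Unfolding `inS`. [folklore] -/
theorem inS_def : inS = (Monoid.CoprodI.of : Fac true →* FP) genS := rfl
/-- Unfolding `inU`. [folklore] -/
theorem inU_def : inU = (Monoid.CoprodI.of : Fac false →* FP) genU := rfl

/-- `genS² = 1`. [folklore] -/
theorem genS_sq : genS ^ 2 = 1 := by decide
/-- `genU³ = 1`. [folklore] -/
theorem genU_pow_three : genU ^ 3 = 1 := by decide

/-- Every element of `ℤ/2` is a power of the generator. [folklore] -/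
theorem exists_genS_pow (x : Fac true) : ∃ n : ℕ, n < 2 ∧ genS ^ n = x := by
  revert x; decide

/-- Every element of `ℤ/3` is a power of the generator. [folklore] -/
theorem exists_genU_pow (x : Fac false) : ∃ n : ℕ, n < 3 ∧ genU ^ n = x := by
  revert x; decide

/-- The homomorphism `Multiplicative (ZMod m) →* N` determined by an element `n` with `nᵐ = 1`.
[folklore] -/
def zmodHom {N : Type*} [Group N] (m : ℕ) (n : N) (h : n ^ m = 1) :
    Multiplicative (ZMod m) →* N :=
  AddMonoidHom.toMultiplicativeLeft
    (ZMod.lift m ⟨zmultiplesHom (Additive N) (Additive.ofMul n), by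
      change ((m : ℤ) • Additive.ofMul n) = 0
      rw [natCast_zsmul, ← ofMul_pow, h, ofMul_one]⟩)

/-- `zmodHom m n h (k mod m) = nᵏ`. [folklore] -/
theorem zmodHom_ofAdd_intCast {N : Type*} [Group N] (m : ℕ) (n : N) (h : n ^ m = 1) (k : ℤ) :
    zmodHom m n h (Multiplicative.ofAdd (k : ZMod m)) = n ^ k := by
  change Additive.toMul (ZMod.lift m _ (k : ZMod m)) = n ^ k
  rw [ZMod.lift_coe]
  change Additive.toMul (k • Additive.ofMul n) = n ^ k
  rw [← ofMul_zpow, toMul_ofMul]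

/-- `zmodHom m n h (1 mod m) = n`. [folklore] -/
theorem zmodHom_ofAdd_one {N : Type*} [Group N] (m : ℕ) (n : N) (h : n ^ m = 1) :
    zmodHom m n h (Multiplicative.ofAdd (1 : ZMod m)) = n := by
  simpa using zmodHom_ofAdd_intCast m n h 1

/-- The family of homomorphisms on the two factors determined by `x, y` with `x² = 1`, `y³ = 1`.
[folklore] -/
def facHom {N : Type*} [Group N] (x y : N) (hx : x ^ 2 = 1) (hy : y ^ 3 = 1) :
    (b : Bool) → (Fac b →* N)
  | true => zmodHom 2 x hx
  | false => zmodHom 3 y hy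

/-- The homomorphism `ℤ/2 ∗ ℤ/3 →* N` with `inS ↦ x`, `inU ↦ y` (`x² = 1`, `y³ = 1`): the
universal property of the free product. [cite: SerreTrees1980, I.1.2] -/
def pairLift {N : Type*} [Group N] (x y : N) (hx : x ^ 2 = 1) (hy : y ^ 3 = 1) : FP →* N :=
  Monoid.CoprodI.lift (facHom x y hx hy)

/-- `pairLift x y` sends `inS` to `x`. [cite: SerreTrees1980, I.1.2] -/
@[simp] theorem pairLift_inS {N : Type*} [Group N] (x y : N) (hx : x ^ 2 = 1)
    (hy : y ^ 3 = 1) : pairLift x y hx hy inS = x := by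
  rw [pairLift, inS_def, Monoid.CoprodI.lift_of]
  exact zmodHom_ofAdd_one 2 x hx

/-- `pairLift x y` sends `inU` to `y`. [cite: SerreTrees1980, I.1.2] -/
@[simp] theorem pairLift_inU {N : Type*} [Group N] (x y : N) (hx : x ^ 2 = 1)
    (hy : y ^ 3 = 1) : pairLift x y hx hy inU = y := by
  rw [pairLift, inU_def, Monoid.CoprodI.lift_of]
  exact zmodHom_ofAdd_one 3 y hy

/-- `ℤ/2 ∗ ℤ/3` is generated by `inS` and `inU`. [folklore] -/
theorem closure_inS_inU : Subgroup.closure ({inS, inU} : Set FP) = ⊤ := by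
  refine top_le_iff.mp fun w _ ↦ ?_
  have hS : inS ∈ Subgroup.closure ({inS, inU} : Set FP) := Subgroup.subset_closure (by simp)
  have hU : inU ∈ Subgroup.closure ({inS, inU} : Set FP) := Subgroup.subset_closure (by simp)
  suffices h : ∀ w : FP, w ∈ Subgroup.closure ({inS, inU} : Set FP) from h w
  intro w
  induction w using Monoid.CoprodI.induction_on with
  | one => exact one_mem _
  | of b x =>
    cases b with
    | true =>
      obtain ⟨n, -, rfl⟩ := exists_genS_pow x
      rw [map_pow]; exact pow_mem hS _
    | false =>
      obtain ⟨n, -, rfl⟩ := exists_genU_pow x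
      rw [map_pow]; exact pow_mem hU _
  | mul x y hx hy => exact mul_mem hx hy

/-- Two homomorphisms out of `ℤ/2 ∗ ℤ/3` agreeing on the generators are equal. [folklore] -/
theorem pair_hom_ext {N : Type*} [Group N] {φ ψ : FP →* N} (hS : φ inS = ψ inS)
    (hU : φ inU = ψ inU) : φ = ψ :=
  MonoidHom.eq_of_eqOn_dense closure_inS_inU (by rintro g (rfl | rfl) <;> assumption)

/-! ### Ping-pong on the upper half plane -/

/-- The action of `SL(2, ℤ)` on `ℍ` as a homomorphism to the permutations of `ℍ`. [folklore] -/
def act : SL(2, ℤ) →* Equiv.Perm ℍ := MulAction.toPermHom SL(2, ℤ) ℍ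

/-- `act g z = g • z`. [folklore] -/
@[simp] theorem act_apply (g : SL(2, ℤ)) (z : ℍ) : act g z = g • z := rfl

/-- `-1` acts trivially on `ℍ`. [folklore] -/
@[simp] theorem act_neg_one : act (-1) = 1 := by
  ext z : 1
  rw [act_apply, ModularGroup.SL_neg_smul, one_smul]
  rfl

/-- `S` acts on `ℍ` as an involution. [folklore] -/
theorem act_S_sq : act S ^ 2 = 1 := by
  rw [← map_pow, show S ^ 2 = (-1 : SL(2, ℤ)) by decide, act_neg_one]
/-- `U` acts on `ℍ` with order dividing `3`. [folklore] -/
theorem act_U_pow_three : act U ^ 3 = 1 := by rw [← map_pow, U_pow_three, act_neg_one]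

/-- The homomorphism `ℤ/2 ∗ ℤ/3 →* Perm ℍ`, `inS ↦ S`, `inU ↦ U`. [cite: Alperin1993] -/
def toPerm : FP →* Equiv.Perm ℍ := pairLift (act S) (act U) act_S_sq act_U_pow_three

/-- The real part of `S • z = -1/z`. [folklore] -/
theorem re_S_smul (z : ℍ) : (S • z).re = -z.re / Complex.normSq (z : ℂ) := by
  have h : ((S • z : ℍ) : ℂ) = (-(z : ℂ))⁻¹ := by rw [modular_S_smul]
  rw [← UpperHalfPlane.coe_re, h, Complex.inv_re, Complex.neg_re, Complex.normSq_neg,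
    UpperHalfPlane.coe_re]

/-- The real part of `T • z = z + 1`. [folklore] -/
theorem re_T_smul (z : ℍ) : (T • z).re = z.re + 1 := by
  rw [modular_T_smul, UpperHalfPlane.vadd_re, add_comm]

/-- `S` maps the left half of `ℍ` into the right half. [cite: Alperin1993] -/
theorem re_S_smul_pos {z : ℍ} (hz : z.re < 0) : 0 < (S • z).re := by
  rw [re_S_smul]
  exact div_pos (neg_pos.mpr hz) (Complex.normSq_pos.mpr (UpperHalfPlane.ne_zero z))

/-- The real part of `U • z = -1/(z + 1)`. [folklore] -/
theorem re_U_smul (z : ℍ) : (U • z).re = -(z.re + 1) / Complex.normSq ((T • z : ℍ) : ℂ) := by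
  rw [U_def, mul_smul, re_S_smul, re_T_smul]

/-- `U : z ↦ -1/(z + 1)` maps the half plane `-1 < re` into the left half plane.
[cite: Alperin1993] -/
theorem re_U_smul_neg {z : ℍ} (hz : -1 < z.re) : (U • z).re < 0 := by
  rw [re_U_smul]
  exact div_neg_of_neg_of_pos (by linarith) (Complex.normSq_pos.mpr (UpperHalfPlane.ne_zero _))

/-- `U` maps the right half plane into the strip `-1 < re`. [cite: Alperin1993] -/
theorem re_U_smul_gt {z : ℍ} (hz : 0 < z.re) : -1 < (U • z).re := by
  rw [re_U_smul]
  have hw : ((T • z : ℍ) : ℂ).re = z.re + 1 := by rw [UpperHalfPlane.coe_re, re_T_smul]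
  have hns : (z.re + 1) ^ 2 ≤ Complex.normSq ((T • z : ℍ) : ℂ) := by
    rw [Complex.normSq_apply, hw]; nlinarith [sq_nonneg ((T • z : ℍ) : ℂ).im]
  have hpos : 0 < Complex.normSq ((T • z : ℍ) : ℂ) := by nlinarith
  rw [lt_div_iff₀ hpos]; nlinarith

/-- `U` and `U²` map the right half of `ℍ` into the left half. [cite: Alperin1993] -/
theorem re_U_pow_smul_neg {z : ℍ} (hz : 0 < z.re) {n : ℕ} (hn : n = 1 ∨ n = 2) :
    (U ^ n • z).re < 0 := by
  rcases hn with rfl | rfl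
  · rw [pow_one]; exact re_U_smul_neg (by linarith)
  · rw [pow_two, mul_smul]; exact re_U_smul_neg (re_U_smul_gt hz)

/-- The ping-pong table: the right half plane (for the factor of `S`) and the left half plane
(for the factor of `U`). [cite: Alperin1993] -/
def ppSet (b : Bool) : Set ℍ := bif b then {z | 0 < z.re} else {z | z.re < 0}

/-- Membership in the right half plane. [folklore] -/
@[simp] theorem mem_ppSet_true (z : ℍ) : z ∈ ppSet true ↔ 0 < z.re := Iff.rfl
/-- Membership in the left half plane. [folklore] -/
@[simp] theorem mem_ppSet_false (z : ℍ) : z ∈ ppSet false ↔ z.re < 0 := Iff.rfl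

/-- A point of `ℍ` with prescribed real part. [folklore] -/
def pt (x : ℝ) : ℍ := ⟨⟨x, 1⟩, by simp⟩

/-- The real part of `pt x`. [folklore] -/
@[simp] theorem pt_re (x : ℝ) : (pt x).re = x := rfl

/-- The ping-pong sets are nonempty. [folklore] -/
theorem ppSet_nonempty (b : Bool) : (ppSet b).Nonempty := by
  cases b
  · exact ⟨pt (-1), by simp⟩
  · exact ⟨pt 1, by simp⟩

/-- The ping-pong sets are disjoint. [folklore] -/
theorem ppSet_disjoint : Pairwise (Function.onFun Disjoint ppSet) := by
  intro b c hbc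
  rw [Function.onFun, Set.disjoint_left]
  intro z hb hc
  cases b <;> cases c <;> simp at hbc hb hc <;> linarith

/-- `toPerm genS = S`, `toPerm genU = U` as permutations. [folklore] -/
@[simp] theorem toPerm_inS : toPerm inS = act S := pairLift_inS _ _ _ _
/-- `toPerm inU = U` as a permutation of `ℍ`. [folklore] -/
@[simp] theorem toPerm_inU : toPerm inU = act U := pairLift_inU _ _ _ _

/-- The ping-pong condition. [cite: Alperin1993] -/
theorem ping_pong : Pairwise fun b c ↦ ∀ h : Fac b, h ≠ 1 →
    (facHom (act S) (act U) act_S_sq act_U_pow_three b h) • ppSet c ⊆ ppSet b := by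
  intro b c hbc h hne
  cases b with
  | true =>
    cases c with
    | true => exact absurd rfl hbc
    | false =>
      obtain ⟨n, hn, rfl⟩ := exists_genS_pow h
      have hgen : facHom (act S) (act U) act_S_sq act_U_pow_three true genS = act S :=
        zmodHom_ofAdd_one 2 (act S) act_S_sq
      interval_cases n
      · exact absurd (pow_zero _) hne
      · rw [pow_one, hgen]
        rintro _ ⟨z, hz, rfl⟩
        change (act S z) ∈ ppSet true
        rw [act_apply, mem_ppSet_true]
        exact re_S_smul_pos hz
  | false =>
    cases c with
    | false => exact absurd rfl hbc
    | true =>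
      obtain ⟨n, hn, rfl⟩ := exists_genU_pow h
      have hgen : facHom (act S) (act U) act_S_sq act_U_pow_three false genU = act U :=
        zmodHom_ofAdd_one 3 (act U) act_U_pow_three
      rw [map_pow, hgen, ← map_pow]
      rintro _ ⟨z, hz, rfl⟩
      rw [mem_ppSet_false]
      change (act (U ^ n) z).re < 0
      rw [act_apply]
      interval_cases n
      · exact absurd (pow_zero _) hne
      · exact re_U_pow_smul_neg hz (Or.inl rfl)
      · exact re_U_pow_smul_neg hz (Or.inr rfl)

/-- **`ℤ/2 ∗ ℤ/3` acts faithfully on `ℍ` through `S`, `U`** (ping-pong). [cite: Alperin1993]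
[cite: SerreTrees1980, I.4.2] -/
theorem toPerm_injective : Function.Injective toPerm := by
  refine Monoid.CoprodI.lift_injective_of_ping_pong (facHom (act S) (act U) act_S_sq act_U_pow_three)
    (Or.inr ⟨false, ?_⟩) ppSet ppSet_nonempty ppSet_disjoint ping_pong
  rw [Cardinal.mk_fintype]
  norm_cast

/-! ### `SL(2, ℤ) → ℤ/2 ∗ ℤ/3` -/

/-- The action of `SL(2, ℤ)` on `ℍ` factors through `ℤ/2 ∗ ℤ/3`. [folklore] -/
theorem range_act_le : act.range ≤ toPerm.range := by
  rw [MonoidHom.range_eq_map, ← closure_S_U, MonoidHom.map_closure]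
  refine (Subgroup.closure_le _).mpr ?_
  rintro _ ⟨g, (rfl | rfl), rfl⟩
  · exact ⟨_, toPerm_inS⟩
  · exact ⟨_, toPerm_inU⟩

/-- Every `g ∈ SL(2, ℤ)` acts on `ℍ` as an element of the image of `ℤ/2 ∗ ℤ/3`. [folklore] -/
theorem act_mem_range (g : SL(2, ℤ)) : act g ∈ toPerm.range := range_act_le ⟨g, rfl⟩

/-- **The canonical surjection `SL(2, ℤ) → ℤ/2 ∗ ℤ/3`** (`S ↦ inS`, `U ↦ inU`, killing `±1`):
`toPerm⁻¹` composed with the action on `ℍ`. [cite: SerreTrees1980, I.4.2] [cite: Alperin1993] -/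
def fromSL : SL(2, ℤ) →* FP :=
  (MonoidHom.ofInjective toPerm_injective).symm.toMonoidHom.comp
    (act.codRestrict toPerm.range act_mem_range)

/-- `toPerm (fromSL g)` is the action of `g` on `ℍ`. [folklore] -/
@[simp] theorem toPerm_fromSL (g : SL(2, ℤ)) : toPerm (fromSL g) = act g := by
  change toPerm ((MonoidHom.ofInjective toPerm_injective).symm ⟨act g, act_mem_range g⟩) = act g
  have := MonoidHom.apply_ofInjective_symm toPerm_injective ⟨act g, act_mem_range g⟩
  exact this

/-- `fromSL S = inS`. [cite: SerreTrees1980, I.4.2] -/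
@[simp] theorem fromSL_S : fromSL S = inS :=
  toPerm_injective (by rw [toPerm_fromSL, toPerm_inS])

/-- `fromSL U = inU`. [cite: SerreTrees1980, I.4.2] -/
@[simp] theorem fromSL_U : fromSL U = inU :=
  toPerm_injective (by rw [toPerm_fromSL, toPerm_inU])

/-- `fromSL (-1) = 1`. [folklore] -/
@[simp] theorem fromSL_neg_one : fromSL (-1) = 1 :=
  toPerm_injective (by rw [toPerm_fromSL, act_neg_one, map_one])

/-- `fromSL (-g) = fromSL g`. [folklore] -/
theorem fromSL_neg (g : SL(2, ℤ)) : fromSL (-g) = fromSL g := by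
  rw [← neg_one_mul, map_mul, fromSL_neg_one, one_mul]

/-- `fromSL` is surjective. [cite: SerreTrees1980, I.4.2] -/
theorem fromSL_surjective : Function.Surjective fromSL := by
  rw [← MonoidHom.range_eq_top, ← top_le_iff, ← closure_inS_inU]
  refine (Subgroup.closure_le _).mpr ?_
  rintro _ (rfl | rfl)
  · exact ⟨S, fromSL_S⟩
  · exact ⟨U, fromSL_U⟩

/-- The kernel of `fromSL` is the kernel of the action on `ℍ`. [folklore] -/
theorem fromSL_eq_one_iff (g : SL(2, ℤ)) : fromSL g = 1 ↔ ∀ z : ℍ, g • z = z := by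
  rw [← toPerm_injective.eq_iff, toPerm_fromSL, map_one]
  constructor
  · intro h z
    have := congrArg (fun e : Equiv.Perm ℍ ↦ e z) h
    simpa using this
  · intro h
    ext z : 1
    rw [act_apply, h z]
    rfl

/-! ### The universal property of `SL(2, ℤ)` modulo `±1` -/

/-- **`SL(2, ℤ)/{±1} = ⟨S, U ∣ S² = U³ = 1⟩`**: for `x, y` in a group `N` with `x² = 1`, `y³ = 1`,
the homomorphism `SL(2, ℤ) →* N` with `S ↦ x`, `U ↦ y`. [cite: SerreTrees1980, I.4.2]
[cite: Alperin1993] -/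
def liftSL {N : Type*} [Group N] (x y : N) (hx : x ^ 2 = 1) (hy : y ^ 3 = 1) : SL(2, ℤ) →* N :=
  (pairLift x y hx hy).comp fromSL

/-- `liftSL x y` sends `S` to `x`. [folklore] -/
@[simp] theorem liftSL_S {N : Type*} [Group N] (x y : N) (hx : x ^ 2 = 1) (hy : y ^ 3 = 1) :
    liftSL x y hx hy S = x := by
  rw [liftSL, MonoidHom.comp_apply, fromSL_S, pairLift_inS]

/-- `liftSL x y` sends `U` to `y`. [folklore] -/
@[simp] theorem liftSL_U {N : Type*} [Group N] (x y : N) (hx : x ^ 2 = 1) (hy : y ^ 3 = 1) :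
    liftSL x y hx hy U = y := by
  rw [liftSL, MonoidHom.comp_apply, fromSL_U, pairLift_inU]

/-- `liftSL x y` kills `-1`. [folklore] -/
@[simp] theorem liftSL_neg_one {N : Type*} [Group N] (x y : N) (hx : x ^ 2 = 1) (hy : y ^ 3 = 1) :
    liftSL x y hx hy (-1) = 1 := by
  rw [liftSL, MonoidHom.comp_apply, fromSL_neg_one, map_one]

/-- `liftSL x y` sends `T = S⁻¹U` to `x⁻¹y`. [folklore] -/
theorem liftSL_T {N : Type*} [Group N] (x y : N) (hx : x ^ 2 = 1) (hy : y ^ 3 = 1) :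
    liftSL x y hx hy T = x⁻¹ * y := by
  rw [T_eq, map_mul, map_inv, liftSL_S, liftSL_U]

/-- Uniqueness in the universal property. [folklore] -/
theorem liftSL_unique {N : Type*} [Group N] (x y : N) (hx : x ^ 2 = 1) (hy : y ^ 3 = 1)
    (φ : SL(2, ℤ) →* N) (hS : φ S = x) (hU : φ U = y) : φ = liftSL x y hx hy :=
  hom_ext (by rw [hS, liftSL_S]) (by rw [hU, liftSL_U])

/-! ### Crossed homomorphisms on `SL(2, ℤ)` -/

section CrossedHom

variable {R W : Type*} [CommRing R] [AddCommGroup W] [Module R W]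
  (ρ : Representation R SL(2, ℤ) W)

/-- A **crossed homomorphism** (`1`-cocycle) of `SL(2, ℤ)` with values in the representation `ρ`:
`F(gh) = F(g) + ρ(g) F(h)`. [cite: Brown1982, III.1 Ex. 2; Shimura1971, (8.1.1)] -/
def IsCrossedHom (F : SL(2, ℤ) → W) : Prop := ∀ g h, F (g * h) = F g + ρ g (F h)

namespace IsCrossedHom

variable {ρ} {F G : SL(2, ℤ) → W}

/-- `F(1) = 0`. [folklore] -/
theorem map_one (hF : IsCrossedHom ρ F) : F 1 = 0 := by
  have h := hF 1 1
  rw [mul_one, _root_.map_one ρ, Module.End.one_apply] at h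
  simpa using h

/-- `F(g⁻¹) = -ρ(g⁻¹) F(g)`. [folklore] -/
theorem map_inv (hF : IsCrossedHom ρ F) (g : SL(2, ℤ)) : F g⁻¹ = -ρ g⁻¹ (F g) := by
  have h := hF g⁻¹ g
  rw [inv_mul_cancel, hF.map_one] at h
  exact eq_neg_of_add_eq_zero_left h.symm

/-- The relation at `S`: `F(S) + ρ(S)F(S) = F(-1)`. [folklore] -/
theorem apply_S (hF : IsCrossedHom ρ F) : F S + ρ S (F S) = F (-1) := by
  rw [← hF, ← sq, show S ^ 2 = (-1 : SL(2, ℤ)) by decide]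

/-- The relation at `U`: `F(U) + ρ(U)F(U) + ρ(U)²F(U) = F(-1)`. [folklore] -/
theorem apply_U (hF : IsCrossedHom ρ F) : F U + ρ U (F U) + ρ U (ρ U (F U)) = F (-1) := by
  have h2 : F (U * U) = F U + ρ U (F U) := hF U U
  have h3 : F (U * U * U) = F (U * U) + ρ (U * U) (F U) := hF (U * U) U
  rw [map_mul, Module.End.mul_apply, h2] at h3
  rw [← h3, ← U_pow_three, pow_three, mul_assoc]

/-- `2 F(-1) = 0` when `ρ(-1) = 1`. [folklore] -/
theorem two_nsmul_map_neg_one (hF : IsCrossedHom ρ F) (hρ : ρ (-1) = 1) : 2 • F (-1) = 0 := by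
  have h := hF (-1) (-1)
  rw [neg_mul_neg, one_mul, hF.map_one, hρ, Module.End.one_apply] at h
  rw [two_nsmul]
  exact h.symm

/-- `F(-1) = 0` when `ρ(-1) = 1` and `2` is invertible. [folklore] -/
theorem map_neg_one (hF : IsCrossedHom ρ F) (hρ : ρ (-1) = 1) (h2 : IsUnit (2 : R)) :
    F (-1) = 0 := by
  obtain ⟨u, hu⟩ := h2
  have h := hF.two_nsmul_map_neg_one hρ
  rw [← Nat.cast_smul_eq_nsmul R, Nat.cast_ofNat, ← hu] at h
  simpa using congrArg (fun w : W ↦ ((u⁻¹ : Rˣ) : R) • w) h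

/-- Sums of crossed homomorphisms. [folklore] -/
theorem add (hF : IsCrossedHom ρ F) (hG : IsCrossedHom ρ G) : IsCrossedHom ρ (F + G) := by
  intro g h
  simp only [Pi.add_apply, hF g h, hG g h, map_add]
  abel

/-- Scalar multiples of crossed homomorphisms. [folklore] -/
theorem smul (hF : IsCrossedHom ρ F) (c : R) : IsCrossedHom ρ (c • F) := by
  intro g h
  simp only [Pi.smul_apply, hF g h, smul_add, map_smul]

/-- The zero map is a crossed homomorphism. [folklore] -/
theorem zero : IsCrossedHom ρ (0 : SL(2, ℤ) → W) := fun g h ↦ by simp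

/-- **A crossed homomorphism is determined by its values at `S` and `U`** (`S, U` generate).
[cite: Shimura1971, §8.1] -/
theorem ext_of_S_U (hF : IsCrossedHom ρ F) (hG : IsCrossedHom ρ G) (hS : F S = G S)
    (hU : F U = G U) : F = G := by
  let K : Subgroup SL(2, ℤ) :=
    { carrier := {g | F g = G g}
      mul_mem' := fun {a b} ha hb ↦ by
        change F (a * b) = G (a * b)
        rw [hF, hG, show F a = G a from ha, show F b = G b from hb]
      one_mem' := by change F 1 = G 1; rw [hF.map_one, hG.map_one]
      inv_mem' := fun {a} ha ↦ by
        change F a⁻¹ = G a⁻¹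
        rw [hF.map_inv, hG.map_inv, show F a = G a from ha] }
  have hK : K = ⊤ := by
    rw [← top_le_iff, ← closure_S_U]
    exact (Subgroup.closure_le K).mpr (by rintro g (rfl | rfl) <;> assumption)
  funext g
  have : g ∈ K := hK ▸ Subgroup.mem_top g
  exact this

end IsCrossedHom

/-- The `R`-module `Z¹(SL(2, ℤ), ρ)` of crossed homomorphisms. [cite: Brown1982, III.1] -/
def crossedHoms : Submodule R (SL(2, ℤ) → W) where
  carrier := {F | IsCrossedHom ρ F}
  add_mem' := IsCrossedHom.add
  zero_mem' := IsCrossedHom.zero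
  smul_mem' c _ hF := IsCrossedHom.smul hF c

/-- Membership in `crossedHoms`. [folklore] -/
theorem mem_crossedHoms {F : SL(2, ℤ) → W} : F ∈ crossedHoms ρ ↔ IsCrossedHom ρ F := Iff.rfl

/-- Evaluation at `(S, U)`: `Z¹ → W × W`. [folklore] -/
def ev : crossedHoms ρ →ₗ[R] W × W where
  toFun F := (F.1 S, F.1 U)
  map_add' _ _ := rfl
  map_smul' _ _ := rfl

/-- Unfolding `ev`. [folklore] -/
@[simp] theorem ev_apply (F : crossedHoms ρ) : ev ρ F = (F.1 S, F.1 U) := rfl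

/-- **`Z¹ → W × W` is injective.** [cite: Shimura1971, §8.1] -/
theorem ev_injective : Function.Injective (ev ρ) := by
  intro F G h
  simp only [ev_apply, Prod.mk.injEq] at h
  exact Subtype.ext (F.2.ext_of_S_U G.2 h.1 h.2)

/-- The coboundary of `w ∈ W`: `g ↦ ρ(g)w - w`. [cite: Brown1982, III.1] -/
def cobd : W →ₗ[R] crossedHoms ρ where
  toFun w := ⟨fun g ↦ ρ g w - w, fun g h ↦ by
    simp only [map_mul, Module.End.mul_apply, map_sub]; abel⟩
  map_add' v w := by ext g; simp only [map_add, Submodule.coe_add, Pi.add_apply]; abel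
  map_smul' c w := by ext g; simp [smul_sub]

/-- Unfolding `cobd`. [folklore] -/
@[simp] theorem cobd_apply (w : W) (g : SL(2, ℤ)) : (cobd ρ w).1 g = ρ g w - w := rfl

/-- `ev` of a coboundary. [folklore] -/
theorem ev_cobd (w : W) : ev ρ (cobd ρ w) = (ρ S w - w, ρ U w - w) := rfl

/-- The kernel of the coboundary map is the module of invariants `W^{SL(2, ℤ)} = W^S ∩ W^U`.
[folklore] -/
theorem ker_cobd : LinearMap.ker (cobd ρ) = LinearMap.ker (ρ S - 1) ⊓ LinearMap.ker (ρ U - 1) := by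
  ext w
  simp only [LinearMap.mem_ker, Submodule.mem_inf, LinearMap.sub_apply, Module.End.one_apply]
  constructor
  · intro h
    have hS := congrArg (fun F : crossedHoms ρ ↦ F.1 S) h
    have hU := congrArg (fun F : crossedHoms ρ ↦ F.1 U) h
    exact ⟨hS, hU⟩
  · rintro ⟨hS, hU⟩
    apply ev_injective
    rw [ev_cobd, map_zero, hS, hU, Prod.mk_zero_zero]

/-- The kernel of the coboundary map is the module of invariants. [cite: Brown1982, III.1] -/
theorem ker_cobd_eq_invariants : LinearMap.ker (cobd ρ) = ρ.invariants := by
  ext w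
  simp only [LinearMap.mem_ker, Representation.mem_invariants]
  constructor
  · intro h g
    have := congrArg (fun F : crossedHoms ρ ↦ F.1 g) h
    simpa [sub_eq_zero] using this
  · intro h
    ext g
    simp [h g]

/-! #### Existence: the free product enters -/

/-- `ρ` as a homomorphism to the linear automorphisms of `W`. [folklore] -/
def ρEquiv : SL(2, ℤ) →* (W ≃ₗ[R] W) :=
  (LinearMap.GeneralLinearGroup.generalLinearEquiv R W).toMonoidHom.comp ρ.asGroupHom

/-- Unfolding `ρEquiv`. [folklore] -/
@[simp] theorem ρEquiv_apply (g : SL(2, ℤ)) (w : W) : ρEquiv ρ g w = ρ g w := by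
  change ((LinearMap.GeneralLinearGroup.generalLinearEquiv R W (ρ.asGroupHom g)) : W → W) w = _
  rw [LinearMap.GeneralLinearGroup.coeFn_generalLinearEquiv, Representation.asGroupHom_apply]

/-- The affine automorphism `v ↦ w + ρ(g)v` of `W`. [folklore] -/
def aff (g : SL(2, ℤ)) (w : W) : W ≃ᵃ[R] W :=
  AffineEquiv.constVAdd R W w * (ρEquiv ρ g).toAffineEquiv

/-- `aff ρ g w v = w + ρ(g)v`. [folklore] -/
@[simp] theorem aff_apply (g : SL(2, ℤ)) (w v : W) : aff ρ g w v = w + ρ g v := by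
  rw [← ρEquiv_apply]; rfl

/-- The linear part of `aff ρ g w` is `ρ(g)`. [folklore] -/
@[simp] theorem linear_aff (g : SL(2, ℤ)) (w : W) : (aff ρ g w).linear = ρEquiv ρ g :=
  LinearEquiv.ext fun _ ↦ rfl

variable {ρ}

/-- `v ↦ w_S + ρ(S)v` has order `2` when `w_S + ρ(S)w_S = 0` and `ρ(-1) = 1`. [folklore] -/
theorem aff_S_sq (hρ : ρ (-1) = 1) {wS : W} (hS : wS + ρ S wS = 0) : aff ρ S wS ^ 2 = 1 := by
  ext v
  have h : ρ S (ρ S v) = v := by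
    rw [← Module.End.mul_apply, ← map_mul, ← sq, show S ^ 2 = (-1 : SL(2, ℤ)) by decide, hρ,
      Module.End.one_apply]
  rw [sq, AffineEquiv.coe_mul, Function.comp_apply, aff_apply, aff_apply, map_add, ← add_assoc, hS,
    zero_add, h, AffineEquiv.coe_one, id_eq]

/-- `v ↦ w_U + ρ(U)v` has order `3` when `w_U + ρ(U)w_U + ρ(U)²w_U = 0` and `ρ(-1) = 1`.
[folklore] -/
theorem aff_U_pow_three (hρ : ρ (-1) = 1) {wU : W} (hU : wU + ρ U wU + ρ U (ρ U wU) = 0) :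
    aff ρ U wU ^ 3 = 1 := by
  ext v
  have h : ρ U (ρ U (ρ U v)) = v := by
    rw [← Module.End.mul_apply, ← Module.End.mul_apply, ← map_mul, ← map_mul, ← pow_three',
      U_pow_three, hρ, Module.End.one_apply]
  rw [pow_three', AffineEquiv.coe_mul, AffineEquiv.coe_mul, Function.comp_apply,
    Function.comp_apply, aff_apply, aff_apply, aff_apply, map_add, map_add, map_add, ← add_assoc,
    ← add_assoc, hU, zero_add, h, AffineEquiv.coe_one, id_eq]

/-- **Existence of crossed homomorphisms with prescribed values at `S` and `U`**: if `ρ(-1) = 1`,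
every pair `(w_S, w_U)` with `(1 + ρS)w_S = 0`, `(1 + ρU + ρU²)w_U = 0` is `(F(S), F(U))` for a
crossed homomorphism `F` — the orbit map of `0` under the homomorphism
`SL(2, ℤ) → Aff(W)`, `S ↦ (v ↦ w_S + ρ(S)v)`, `U ↦ (v ↦ w_U + ρ(U)v)` furnished by
`PSL₂(ℤ) = ℤ/2 ∗ ℤ/3`. [cite: SerreTrees1980, I.4.2 and II.2.8] [cite: Brown1982, VII.9] -/
theorem exists_isCrossedHom (hρ : ρ (-1) = 1) {wS wU : W} (hS : wS + ρ S wS = 0)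
    (hU : wU + ρ U wU + ρ U (ρ U wU) = 0) :
    ∃ F : SL(2, ℤ) → W, IsCrossedHom ρ F ∧ F S = wS ∧ F U = wU := by
  let φ : SL(2, ℤ) →* (W ≃ᵃ[R] W) :=
    liftSL (aff ρ S wS) (aff ρ U wU) (aff_S_sq hρ hS) (aff_U_pow_three hρ hU)
  have hlin : AffineEquiv.linearHom.comp φ = ρEquiv ρ :=
    hom_ext (by rw [MonoidHom.comp_apply, liftSL_S, AffineEquiv.linearHom_apply, linear_aff])
      (by rw [MonoidHom.comp_apply, liftSL_U, AffineEquiv.linearHom_apply, linear_aff])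
  refine ⟨fun g ↦ φ g 0, fun g h ↦ ?_, ?_, ?_⟩
  · have h1 : φ (g * h) 0 = φ g (φ h 0) := by
      rw [map_mul, AffineEquiv.coe_mul, Function.comp_apply]
    have h2 : φ g (φ h 0) = (φ g).linear (φ h 0) +ᵥ φ g 0 := by
      rw [← AffineEquiv.map_vadd, vadd_eq_add, add_zero]
    have h3 : (φ g).linear (φ h 0) = ρ g (φ h 0) := by
      rw [← AffineEquiv.linearHom_apply, ← MonoidHom.comp_apply, hlin, ρEquiv_apply]
    change φ (g * h) 0 = φ g 0 + ρ g (φ h 0)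
    rw [h1, h2, h3, vadd_eq_add, add_comm]
  · have hφ : φ S = aff ρ S wS := liftSL_S _ _ _ _
    change φ S 0 = wS
    rw [hφ, aff_apply, map_zero, add_zero]
  · have hφ : φ U = aff ρ U wU := liftSL_U _ _ _ _
    change φ U 0 = wU
    rw [hφ, aff_apply, map_zero, add_zero]

/-- **The image of `Z¹ → W × W`** is `ker(1 + ρS) × ker(1 + ρU + ρU²)` (for `ρ(-1) = 1` and `2`
invertible in `R`, so that `F(-1) = 0` for every crossed homomorphism).
[cite: SerreTrees1980, II.2.8] [cite: Brown1982, VII.9] -/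
theorem range_ev (hρ : ρ (-1) = 1) (h2 : IsUnit (2 : R)) :
    LinearMap.range (ev ρ) =
      (LinearMap.ker (1 + ρ S)).prod (LinearMap.ker (1 + ρ U + ρ U * ρ U)) := by
  ext ⟨wS, wU⟩
  simp only [LinearMap.mem_range, Submodule.mem_prod, LinearMap.mem_ker, LinearMap.add_apply,
    Module.End.one_apply, Module.End.mul_apply]
  constructor
  · rintro ⟨F, hF⟩
    rw [ev_apply, Prod.mk.injEq] at hF
    obtain ⟨rfl, rfl⟩ := hF
    exact ⟨by rw [F.2.apply_S, F.2.map_neg_one hρ h2],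
      by rw [F.2.apply_U, F.2.map_neg_one hρ h2]⟩
  · rintro ⟨hS, hU⟩
    obtain ⟨F, hF, hFS, hFU⟩ := exists_isCrossedHom hρ hS hU
    exact ⟨⟨F, hF⟩, Prod.ext hFS hFU⟩

/-- The evaluation map `Z¹ → ker(1 + ρS) × ker(1 + ρU + ρU²)`. [folklore] -/
def evKer (hρ : ρ (-1) = 1) (h2 : IsUnit (2 : R)) :
    crossedHoms ρ →ₗ[R] LinearMap.ker (1 + ρ S) × LinearMap.ker (1 + ρ U + ρ U * ρ U) where
  toFun F := (⟨F.1 S, by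
      rw [LinearMap.mem_ker, LinearMap.add_apply, Module.End.one_apply, F.2.apply_S,
        F.2.map_neg_one hρ h2]⟩,
    ⟨F.1 U, by
      rw [LinearMap.mem_ker, LinearMap.add_apply, LinearMap.add_apply, Module.End.one_apply,
        Module.End.mul_apply, F.2.apply_U, F.2.map_neg_one hρ h2]⟩)
  map_add' _ _ := rfl
  map_smul' _ _ := rfl

/-- `evKer` is bijective (injective: `ev_injective`; surjective: `exists_isCrossedHom`). [folklore] -/
theorem evKer_bijective (hρ : ρ (-1) = 1) (h2 : IsUnit (2 : R)) :
    Function.Bijective (evKer hρ h2) := by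
  constructor
  · intro F G h
    apply ev_injective
    have h1 := congrArg (fun x ↦ (x.1 : W)) h
    have h2 := congrArg (fun x ↦ (x.2 : W)) h
    exact Prod.ext h1 h2
  · rintro ⟨⟨wS, hS⟩, ⟨wU, hU⟩⟩
    rw [LinearMap.mem_ker, LinearMap.add_apply, Module.End.one_apply] at hS
    rw [LinearMap.mem_ker, LinearMap.add_apply, LinearMap.add_apply, Module.End.one_apply,
      Module.End.mul_apply] at hU
    obtain ⟨F, hF, hFS, hFU⟩ := exists_isCrossedHom hρ hS hU
    refine ⟨⟨F, hF⟩, ?_⟩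
    ext
    · exact hFS
    · exact hFU

/-- **`Z¹(SL(2, ℤ), ρ) ≅ ker(1 + ρS) × ker(1 + ρU + ρU²)`** (`ρ(-1) = 1`, `2 ∈ Rˣ`).
[cite: SerreTrees1980, II.2.8] [cite: Brown1982, VII.9] -/
def crossedHomsEquiv (hρ : ρ (-1) = 1) (h2 : IsUnit (2 : R)) :
    crossedHoms ρ ≃ₗ[R] LinearMap.ker (1 + ρ S) × LinearMap.ker (1 + ρ U + ρ U * ρ U) :=
  LinearEquiv.ofBijective (evKer hρ h2) (evKer_bijective hρ h2)

/-- Unfolding `crossedHomsEquiv`. [folklore] -/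
@[simp] theorem crossedHomsEquiv_apply (hρ : ρ (-1) = 1) (h2 : IsUnit (2 : R)) (F : crossedHoms ρ) :
    crossedHomsEquiv hρ h2 F = evKer hρ h2 F := rfl

end CrossedHom

/-! ### The dimension of `H¹(SL(2, ℤ), W)` over a field in which `6 ≠ 0` -/

section Field

variable {K W : Type*} [Field K] [AddCommGroup W] [Module K W]

/-- `ker(1 + s) = range(s - 1)` for an involution `s`, when `2 ≠ 0`. [folklore] -/
theorem ker_one_add_eq_range {s : Module.End K W} (hs : s * s = 1) (h2 : (2 : K) ≠ 0) :
    LinearMap.ker (1 + s) = LinearMap.range (s - 1) := by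
  ext w
  simp only [LinearMap.mem_ker, LinearMap.add_apply, Module.End.one_apply, LinearMap.mem_range,
    LinearMap.sub_apply]
  constructor
  · intro h
    have hsw : s w = -w := eq_neg_of_add_eq_zero_right h
    refine ⟨-((2 : K)⁻¹ • w), ?_⟩
    rw [map_neg, map_smul, hsw, smul_neg, neg_neg, sub_neg_eq_add, ← add_smul,
      ← two_mul, mul_inv_cancel₀ h2, one_smul]
  · rintro ⟨v, rfl⟩
    rw [map_sub, ← Module.End.mul_apply, hs, Module.End.one_apply]
    abel

/-- `ker(1 + u + u²) = range(u - 1)` for `u³ = 1`, when `3 ≠ 0`. [folklore] -/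
theorem ker_one_add_add_eq_range {u : Module.End K W} (hu : u * u * u = 1) (h3 : (3 : K) ≠ 0) :
    LinearMap.ker (1 + u + u * u) = LinearMap.range (u - 1) := by
  ext w
  simp only [LinearMap.mem_ker, LinearMap.add_apply, Module.End.one_apply, Module.End.mul_apply,
    LinearMap.mem_range, LinearMap.sub_apply]
  constructor
  · intro h
    have huu : u (u w) = -w - u w := by rw [eq_sub_iff_add_eq, eq_neg_iff_add_eq_zero, ← h]; abel
    have hu3 : u (u (u w)) = w := by
      rw [← Module.End.mul_apply, ← Module.End.mul_apply, hu, Module.End.one_apply]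
    refine ⟨(3 : K)⁻¹ • (u (u w) - w), ?_⟩
    have key : u (u (u w) - w) - (u (u w) - w) = (3 : K) • w := by
      rw [map_sub, hu3, huu, show (3 : K) = 1 + 1 + 1 by norm_num, add_smul, add_smul, one_smul]
      abel
    rw [map_smul, ← smul_sub, key, smul_smul, inv_mul_cancel₀ h3, one_smul]
  · rintro ⟨v, rfl⟩
    have hu3 : u (u (u v)) = v := by
      rw [← Module.End.mul_apply, ← Module.End.mul_apply, hu, Module.End.one_apply]
    simp only [map_sub, hu3]
    abel

variable [FiniteDimensional K W] (ρ : Representation K SL(2, ℤ) W)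

/-- `Z¹` is a finite module (it embeds in `W × W`). [folklore] -/
instance : Module.Finite K (crossedHoms ρ) := Module.Finite.of_injective (ev ρ) (ev_injective ρ)

/-- **`dim Z¹(SL(2, ℤ), W) + dim W^S + dim W^U = 2 dim W`** for a representation with `ρ(-1) = 1`
over a field with `2, 3 ≠ 0`. [cite: SerreTrees1980, II.2.8] [cite: Shimura1971, §8.1 Prop. 8.1] -/
theorem finrank_crossedHoms_add (hρ : ρ (-1) = 1) (h2 : (2 : K) ≠ 0) (h3 : (3 : K) ≠ 0) :
    Module.finrank K (crossedHoms ρ) + Module.finrank K (LinearMap.ker (ρ S - 1)) +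
      Module.finrank K (LinearMap.ker (ρ U - 1)) = 2 * Module.finrank K W := by
  have hS2 : ρ S * ρ S = 1 := by rw [← map_mul, ← sq, show S ^ 2 = (-1 : SL(2, ℤ)) by decide, hρ]
  have hU3 : ρ U * ρ U * ρ U = 1 := by rw [← map_mul, ← map_mul, ← pow_three', U_pow_three, hρ]
  rw [(crossedHomsEquiv hρ (Ne.isUnit h2)).finrank_eq, Module.finrank_prod,
    ker_one_add_eq_range hS2 h2, ker_one_add_add_eq_range hU3 h3]
  have eS := LinearMap.finrank_range_add_finrank_ker (ρ S - 1)
  have eU := LinearMap.finrank_range_add_finrank_ker (ρ U - 1)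
  omega

/-- **`dim B¹(SL(2, ℤ), W) + dim (W^S ∩ W^U) = dim W`.** [folklore] -/
theorem finrank_range_cobd_add :
    Module.finrank K (LinearMap.range (cobd ρ)) +
      Module.finrank K ↥(LinearMap.ker (ρ S - 1) ⊓ LinearMap.ker (ρ U - 1)) =
        Module.finrank K W := by
  rw [← ker_cobd]
  exact LinearMap.finrank_range_add_finrank_ker (cobd ρ)

/-- **The dimension of `H¹(SL(2, ℤ), W) = Z¹/B¹`**:
`dim H¹ + dim W^S + dim W^U = dim W + dim(W^S ∩ W^U)`, i.e.
`dim H¹ = dim W - dim W^S - dim W^U + dim W^{SL(2, ℤ)}` (`ρ(-1) = 1`, `2, 3 ≠ 0` in `K`) — the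
Mayer–Vietoris count for `PSL₂(ℤ) = ℤ/2 ∗ ℤ/3`. [cite: SerreTrees1980, II.2.8]
[cite: Brown1982, VII.9] [cite: Shimura1971, §8.1 Prop. 8.1] -/
theorem finrank_H1_add (hρ : ρ (-1) = 1) (h2 : (2 : K) ≠ 0) (h3 : (3 : K) ≠ 0) :
    Module.finrank K (crossedHoms ρ ⧸ LinearMap.range (cobd ρ)) +
        Module.finrank K (LinearMap.ker (ρ S - 1)) + Module.finrank K (LinearMap.ker (ρ U - 1)) =
      Module.finrank K W +
        Module.finrank K ↥(LinearMap.ker (ρ S - 1) ⊓ LinearMap.ker (ρ U - 1)) := by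
  have hq := (LinearMap.range (cobd ρ)).finrank_quotient_add_finrank
  have hZ := finrank_crossedHoms_add ρ hρ h2 h3
  have hB := finrank_range_cobd_add ρ
  omega

end Field

end ModularGroupFreeProduct

end Literature.GroupTheory.SpecificGroups
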